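import Mathlib
import HarnessLib
import Literature.Computability.AlgebraicComplexity.PatternExpressions
import Summits.ValiantsHypothesis.ValiantsHypothesis.Theorems.MonotoneRestorationOrbitRestorationQPHomSpan

/-!
# Matrix-symmetric polynomials are spanned by homomorphism polynomials of ADMISSIBLE patterns
# (no isolated vertices, at most `min(deg, n)` vertices a side)

Route MonotoneRestoration; cruxes `OrbitRestorationQP` (stmt-18293, K1) / `NonnegRestorationQP` (stmt-16191)
/ aside `OrbitRestorationLinearVolumeQP` (stmt-18294, "unique order-`n` expansion").  Refinement of
`HomSpan.mem_span_homPoly_of_matrixSymmetric` keeping the bookkeeping that the uniqueness theorem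
(Dwivedi–Pago–Seppelt 2026 Lemma 8.18, tree `HomPolyBasics.linearIndependent_homPoly` /
`homPoly_expansion_unique`) asks of a pattern family: NO ISOLATED VERTICES and AT MOST `n` VERTICES A SIDE.
The patterns produced by the spanning induction have both properties (they are the patterns of monomial
exponents on the `n × n` matrix, transported along `Fintype.equivFin`), so:

* `mem_span_admissible_of_matrixSymmetric` — every matrix-symmetric polynomial `p` on the `n × n` matrix
  lies in the `ℂ`-span of `hom_{F,n}` over patterns `F = (Fin a ⊔ Fin b, E)` with `a, b ≤ min(deg p, n)`,
  `|E| ≤ deg p`, and no isolated vertices.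

With Lemma 8.18 this makes the expansion of a matrix-symmetric polynomial in (isomorphism classes of)
admissible patterns UNIQUE — the basis theorem behind K1's "the homomorphism expansion" and 18294's
"unique order-`n` expansion".  Def-free. [cite: DwivediPagoSeppelt2026, §8 (Lemma 8.18)]
-/

noncomputable section

open MvPolynomial

-- `Summit.ValiantsHypothesis.ValiantsHypothesis.…` is the tree's single-conjunct layout (Sub = Summit).
set_option linter.dupNamespace false

namespace Summit.ValiantsHypothesis.ValiantsHypothesis.Theorems

namespace HomSpan

open Literature.Computability.AlgebraicComplexity

variable {n : ℕ}

/-- Transport to `Fin a × Fin b` keeping admissibility. [folklore] -/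
theorem homPoly_mem_admissibleSet {A B : Type} [Fintype A] [DecidableEq A] [Fintype B] [DecidableEq B]
    (E : Multiset (A × B)) (n d : ℕ) (hA : Fintype.card A ≤ d) (hB : Fintype.card B ≤ d)
    (hAn : Fintype.card A ≤ n) (hBn : Fintype.card B ≤ n) (hE : Multiset.card E ≤ d)
    (hEA : ∀ a, ∃ e ∈ E, e.1 = a) (hEB : ∀ b, ∃ e ∈ E, e.2 = b) :
    homPoly E n ℂ ∈ {q : MvPolynomial (Fin n × Fin n) ℂ | ∃ (a b : ℕ) (E' : Multiset (Fin a × Fin b)),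
      a ≤ n ∧ b ≤ n ∧ a ≤ d ∧ b ≤ d ∧ Multiset.card E' ≤ d ∧
      (∀ u : Fin a, ∃ e ∈ E', e.1 = u) ∧ (∀ v : Fin b, ∃ e ∈ E', e.2 = v) ∧ q = homPoly E' n ℂ} := by
  refine ⟨Fintype.card A, Fintype.card B,
    E.map fun e => (Fintype.equivFin A e.1, Fintype.equivFin B e.2), hAn, hBn, hA, hB, by simpa using hE,
    fun u => ?_, fun v => ?_, ?_⟩
  · obtain ⟨e, he, hea⟩ := hEA ((Fintype.equivFin A).symm u)
    exact ⟨_, Multiset.mem_map_of_mem _ he, by simp [hea]⟩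
  · obtain ⟨e, he, heb⟩ := hEB ((Fintype.equivFin B).symm v)
    exact ⟨_, Multiset.mem_map_of_mem _ he, by simp [heb]⟩
  · rw [HomPolyBasics.homPoly_map_equiv]

/-- **Orbit sums lie in the span of homomorphism polynomials of admissible patterns** (as
`orbitSum_mem_span_homPoly`, with the admissibility bookkeeping). [cite: DwivediPagoSeppelt2026, §8] -/
theorem orbitSum_mem_span_admissible (d : ℕ) :
    ∀ (ν : ℕ) (D : (Fin n × Fin n) →₀ ℕ),
      (D.support.image Prod.fst).card + (D.support.image Prod.snd).card = ν →
      Multiset.card (Finsupp.toMultiset D) ≤ d →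
      (∑ g : Equiv.Perm (Fin n) × Equiv.Perm (Fin n),
          monomial (D.mapDomain fun ij : Fin n × Fin n => (g.1 ij.1, g.2 ij.2)) (1 : ℂ)) ∈
        Submodule.span ℂ {q : MvPolynomial (Fin n × Fin n) ℂ | ∃ (a b : ℕ) (E : Multiset (Fin a × Fin b)),
          a ≤ n ∧ b ≤ n ∧ a ≤ d ∧ b ≤ d ∧ Multiset.card E ≤ d ∧
          (∀ u : Fin a, ∃ e ∈ E, e.1 = u) ∧ (∀ v : Fin b, ∃ e ∈ E, e.2 = v) ∧ q = homPoly E n ℂ} := by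
  classical
  intro ν
  induction ν using Nat.strong_induction_on with
  | _ ν ih =>
  intro D hν hd
  obtain ⟨A, B, iA, dA, iB, dB, E, h₀, hEA, hEB, h₁, h₂, hD, hcA, hcB, hcE⟩ := exists_presentation D
  set I : Finset ((A → Fin n) × (B → Fin n)) :=
    Finset.univ.filter fun h => Function.Injective h.1 ∧ Function.Injective h.2 with hI
  have h₀I : h₀ ∈ I := Finset.mem_filter.2 ⟨Finset.mem_univ _, h₁, h₂⟩
  have hR := card_smul_homPoly_eq_sum_orbitSum E n
  rw [← Finset.sum_filter_add_sum_filter_not Finset.univ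
    (fun h : (A → Fin n) × (B → Fin n) => Function.Injective h.1 ∧ Function.Injective h.2)] at hR
  have hinj : ∑ h ∈ I, ∑ g : Equiv.Perm (Fin n) × Equiv.Perm (Fin n),
      monomial ((Multiset.toFinsupp (E.map fun e => (h.1 e.1, h.2 e.2))).mapDomain
        fun ij : Fin n × Fin n => (g.1 ij.1, g.2 ij.2)) (1 : ℂ) =
      (I.card : ℂ) • ∑ g : Equiv.Perm (Fin n) × Equiv.Perm (Fin n),
        monomial (D.mapDomain fun ij : Fin n × Fin n => (g.1 ij.1, g.2 ij.2)) (1 : ℂ) := by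
    rw [Finset.sum_congr rfl fun h hh => ?_, Finset.sum_const, ← Nat.cast_smul_eq_nsmul ℂ]
    obtain ⟨-, hh1, hh2⟩ := Finset.mem_filter.1 hh
    rw [orbitSum_push_eq_of_injective E h₀ h h₁ h₂ hh1 hh2, hD]
  have hnon : ∀ h ∈ Finset.univ.filter (fun h : (A → Fin n) × (B → Fin n) =>
      ¬ (Function.Injective h.1 ∧ Function.Injective h.2)),
      (∑ g : Equiv.Perm (Fin n) × Equiv.Perm (Fin n),
        monomial ((Multiset.toFinsupp (E.map fun e => (h.1 e.1, h.2 e.2))).mapDomain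
          fun ij : Fin n × Fin n => (g.1 ij.1, g.2 ij.2)) (1 : ℂ)) ∈
        Submodule.span ℂ {q : MvPolynomial (Fin n × Fin n) ℂ | ∃ (a b : ℕ) (E : Multiset (Fin a × Fin b)),
          a ≤ n ∧ b ≤ n ∧ a ≤ d ∧ b ≤ d ∧ Multiset.card E ≤ d ∧
          (∀ u : Fin a, ∃ e ∈ E, e.1 = u) ∧ (∀ v : Fin b, ∃ e ∈ E, e.2 = v) ∧ q = homPoly E n ℂ} := by
    intro h hh
    obtain ⟨-, hh⟩ := Finset.mem_filter.1 hh
    refine ih _ ?_ _ rfl (by rw [card_toMultiset_push, hcE]; exact hd)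
    rw [← hν, support_push_image_fst E hEA, support_push_image_snd E hEB, ← hcA, ← hcB]
    have le1 : (Finset.univ.image h.1).card ≤ Fintype.card A := Finset.card_image_le.trans (by simp)
    have le2 : (Finset.univ.image h.2).card ≤ Fintype.card B := Finset.card_image_le.trans (by simp)
    rcases not_and_or.1 hh with hn1 | hn2
    · have lt1 : (Finset.univ.image h.1).card < Fintype.card A := by
        refine lt_of_le_of_ne le1 fun heq => hn1 ?_
        have := Finset.injOn_of_card_image_eq (s := Finset.univ) (f := h.1)
          (by rw [Finset.card_univ]; exact heq)
        simpa [Set.injOn_univ] using this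
      omega
    · have lt2 : (Finset.univ.image h.2).card < Fintype.card B := by
        refine lt_of_le_of_ne le2 fun heq => hn2 ?_
        have := Finset.injOn_of_card_image_eq (s := Finset.univ) (f := h.2)
          (by rw [Finset.card_univ]; exact heq)
        simpa [Set.injOn_univ] using this
      omega
  have hhom : homPoly E n ℂ ∈ Submodule.span ℂ {q : MvPolynomial (Fin n × Fin n) ℂ |
      ∃ (a b : ℕ) (E : Multiset (Fin a × Fin b)), a ≤ n ∧ b ≤ n ∧ a ≤ d ∧ b ≤ d ∧ Multiset.card E ≤ d ∧
        (∀ u : Fin a, ∃ e ∈ E, e.1 = u) ∧ (∀ v : Fin b, ∃ e ∈ E, e.2 = v) ∧ q = homPoly E n ℂ} := by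
    refine Submodule.subset_span (homPoly_mem_admissibleSet E n d ?_ ?_ ?_ ?_ (hcE ▸ hd) hEA hEB)
    · rw [hcA]; exact (card_image_fst_le_card D).trans hd
    · rw [hcB]; exact (card_image_snd_le_card D).trans hd
    · rw [hcA]; exact (Finset.card_le_univ _).trans (by simp)
    · rw [hcB]; exact (Finset.card_le_univ _).trans (by simp)
  have hIne : (I.card : ℂ) ≠ 0 := Nat.cast_ne_zero.2 (Finset.card_ne_zero.2 ⟨h₀, h₀I⟩)
  rw [hinj] at hR
  have hsolve : (∑ g : Equiv.Perm (Fin n) × Equiv.Perm (Fin n),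
      monomial (D.mapDomain fun ij : Fin n × Fin n => (g.1 ij.1, g.2 ij.2)) (1 : ℂ)) =
      (I.card : ℂ)⁻¹ • ((Fintype.card (Equiv.Perm (Fin n) × Equiv.Perm (Fin n)) : ℂ) • homPoly E n ℂ -
        ∑ h ∈ Finset.univ.filter (fun h : (A → Fin n) × (B → Fin n) =>
            ¬ (Function.Injective h.1 ∧ Function.Injective h.2)),
          ∑ g : Equiv.Perm (Fin n) × Equiv.Perm (Fin n),
            monomial ((Multiset.toFinsupp (E.map fun e => (h.1 e.1, h.2 e.2))).mapDomain
              fun ij : Fin n × Fin n => (g.1 ij.1, g.2 ij.2)) (1 : ℂ)) := by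
    rw [hR, add_sub_cancel_right, smul_smul, inv_mul_cancel₀ hIne, one_smul]
  rw [hsolve]
  exact Submodule.smul_mem _ _ (Submodule.sub_mem _ (Submodule.smul_mem _ _ hhom)
    (Submodule.sum_mem _ hnon))

/-- **Matrix-symmetric polynomials are combinations of homomorphism polynomials of ADMISSIBLE patterns**:
`a, b ≤ min(deg p, n)` vertices a side, `≤ deg p` edges, no isolated vertices — the pattern families on
which the expansion is unique by DPS26 Lemma 8.18. [cite: DwivediPagoSeppelt2026, §8 (Lemma 8.18)] -/
theorem mem_span_admissible_of_matrixSymmetric (p : MvPolynomial (Fin n × Fin n) ℂ)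
    (hp : ∀ σ τ : Equiv.Perm (Fin n),
      rename (fun ij : Fin n × Fin n => (σ ij.1, τ ij.2)) p = p) :
    p ∈ Submodule.span ℂ {q : MvPolynomial (Fin n × Fin n) ℂ | ∃ (a b : ℕ) (E : Multiset (Fin a × Fin b)),
      a ≤ n ∧ b ≤ n ∧ a ≤ p.totalDegree ∧ b ≤ p.totalDegree ∧ Multiset.card E ≤ p.totalDegree ∧
      (∀ u : Fin a, ∃ e ∈ E, e.1 = u) ∧ (∀ v : Fin b, ∃ e ∈ E, e.2 = v) ∧ q = homPoly E n ℂ} := by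
  classical
  have hG : (Fintype.card (Equiv.Perm (Fin n) × Equiv.Perm (Fin n)) : ℂ) ≠ 0 :=
    Nat.cast_ne_zero.2 Fintype.card_ne_zero
  have key := card_smul_eq_sum_orbitSum p hp
  have hmem : (Fintype.card (Equiv.Perm (Fin n) × Equiv.Perm (Fin n)) : ℂ) • p ∈
      Submodule.span ℂ {q : MvPolynomial (Fin n × Fin n) ℂ | ∃ (a b : ℕ) (E : Multiset (Fin a × Fin b)),
        a ≤ n ∧ b ≤ n ∧ a ≤ p.totalDegree ∧ b ≤ p.totalDegree ∧ Multiset.card E ≤ p.totalDegree ∧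
        (∀ u : Fin a, ∃ e ∈ E, e.1 = u) ∧ (∀ v : Fin b, ∃ e ∈ E, e.2 = v) ∧ q = homPoly E n ℂ} := by
    rw [key]
    refine Submodule.sum_mem _ fun D hD => Submodule.smul_mem _ _
      (orbitSum_mem_span_admissible p.totalDegree _ D rfl ?_)
    rw [Finsupp.card_toMultiset]
    exact le_totalDegree hD
  have := Submodule.smul_mem _ ((Fintype.card (Equiv.Perm (Fin n) × Equiv.Perm (Fin n)) : ℂ)⁻¹) hmem
  rwa [smul_smul, inv_mul_cancel₀ hG, one_smul] at this

end HomSpan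

end Summit.ValiantsHypothesis.ValiantsHypothesis.Theorems

end
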